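import Summits.RiemannHypothesis.RiemannHypothesis.Theses.ScrewSquaringLaw
import Literature.NumberTheory.LFunctions.ZetaScrewThm17Proofs
import HarnessLib

/-!
# Route ScrewSquaringLaw (L45 «SQUARING LAW») — the aside `SquaringLawOfRH` (stmt-RiemannHypothesis-23897)

**RH ⟹ Ψ(2t) ≤ 4·Ψ(t) for every real `t`** (Suzuki's screw function `Ψ = zetaScrew`).  Under RH the tree theorem
`Literature.NumberTheory.LFunctions.ZetaScrewThm17.hasSum_real` (Suzuki 2023 Thm 1.1 (2) read under RH, §7.2) gives,
for EVERY real `t`, `Ψ(t) = Σ_ρ m(ρ)·(1 − cos(γt))/γ²` as a convergent series of non-negative reals over the non-trivial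
zeros `ρ = ½ + iγ`.  Termwise, with `c = cos(γt)` and `cos(2γt) = 2c² − 1`,
`4(1 − c) − (1 − cos 2γt) = 2 − 4c + 2c² = 2(1 − c)² ≥ 0`, so the series for `Ψ(2t)` is dominated term by term by `4×`
the series for `Ψ(t)`, and `hasSum_le` gives `Ψ(2t) ≤ 4Ψ(t)` (no evenness argument is needed: `hasSum_real` has no sign
restriction on `t`).  This documents that the route's residual `SquaringLaw` (item 23896) is RH-implied (category (b)).
Cell rh-split, lead g9 RULING #373 (b) (director-rh g11 00:04:08Z (1): «aside 23897 = cheap typer task»); filer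
rh-split-typer-1 g7.  RH is a HYPOTHESIS of the statement; nothing here bears on the truth of RH.
-/

-- D-0017: `Summit.RiemannHypothesis.RiemannHypothesis.…` duplicates the namespace BY DESIGN (single-problem summit).
set_option linter.dupNamespace false

namespace Summit.RiemannHypothesis.RiemannHypothesis.Theorems.ScrewSquaringLaw

open Literature.NumberTheory.LFunctions

/-- **Termwise squaring inequality** for the summands of `ZetaScrewThm17.hasSum_real`: for every non-trivial zero `ρ`
(order `m(ρ) ≥ 1`, ordinate `γ = Im ρ`) and every real `t`,
`m(ρ)·(1 − cos(γ·2t))/γ² ≤ 4·(m(ρ)·(1 − cos(γt))/γ²)`, because `4(1 − c) − (1 − (2c² − 1)) = 2(1 − c)² ≥ 0` with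
`c = cos(γt)` and `m(ρ)/γ² ≥ 0`. [folklore] -/
theorem realTerm_two_mul_le (ρ : ZetaZeros.riemannZetaNontrivialZeros) (t : ℝ) :
    (riemannZetaZeroOrder (ρ : ℂ) : ℝ) * ((1 - Real.cos ((ρ : ℂ).im * (2 * t))) / (ρ : ℂ).im ^ 2) ≤
      4 * ((riemannZetaZeroOrder (ρ : ℂ) : ℝ) * ((1 - Real.cos ((ρ : ℂ).im * t)) / (ρ : ℂ).im ^ 2)) := by
  have hm : (0 : ℝ) ≤ (riemannZetaZeroOrder (ρ : ℂ) : ℝ) := by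
    have h1 := ZetaZeros.riemannZetaNontrivialZeros.one_le_order ρ.2
    exact_mod_cast (show (0 : ℤ) ≤ riemannZetaZeroOrder (ρ : ℂ) by omega)
  have hg : (0 : ℝ) ≤ ((ρ : ℂ).im ^ 2)⁻¹ := inv_nonneg.mpr (sq_nonneg _)
  have hc : Real.cos ((ρ : ℂ).im * (2 * t)) = 2 * Real.cos ((ρ : ℂ).im * t) ^ 2 - 1 := by
    rw [show (ρ : ℂ).im * (2 * t) = 2 * ((ρ : ℂ).im * t) by ring]
    exact Real.cos_two_mul _
  have key : 0 ≤ 4 * (1 - Real.cos ((ρ : ℂ).im * t)) - (1 - Real.cos ((ρ : ℂ).im * (2 * t))) := by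
    rw [hc]
    nlinarith [sq_nonneg (1 - Real.cos ((ρ : ℂ).im * t))]
  rw [← sub_nonneg]
  have e : 4 * ((riemannZetaZeroOrder (ρ : ℂ) : ℝ) * ((1 - Real.cos ((ρ : ℂ).im * t)) / (ρ : ℂ).im ^ 2)) -
      (riemannZetaZeroOrder (ρ : ℂ) : ℝ) * ((1 - Real.cos ((ρ : ℂ).im * (2 * t))) / (ρ : ℂ).im ^ 2) =
      (riemannZetaZeroOrder (ρ : ℂ) : ℝ) * ((ρ : ℂ).im ^ 2)⁻¹ *
        (4 * (1 - Real.cos ((ρ : ℂ).im * t)) - (1 - Real.cos ((ρ : ℂ).im * (2 * t)))) := by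
    simp only [div_eq_mul_inv]
    ring
  rw [e]
  exact mul_nonneg (mul_nonneg hm hg) key

/-- **`SquaringLawOfRH` holds** (item stmt-RiemannHypothesis-23897, aside): under RH, `Ψ(2t) ≤ 4·Ψ(t)` for every real
`t` — `hasSum_le` on Suzuki's series `ZetaScrewThm17.hasSum_real` at `2t` and (times `4`) at `t`, with the termwise
inequality `realTerm_two_mul_le`. [cite: Suzuki2023, Thm 1.1 (2) and §7.2] -/
theorem squaringLawOfRH_proof :
    Summit.RiemannHypothesis.RiemannHypothesis.Theses.ScrewSquaringLaw.SquaringLawOfRH := by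
  intro hRH t
  exact hasSum_le (fun ρ => realTerm_two_mul_le ρ t) (ZetaScrewThm17.hasSum_real hRH (2 * t))
    ((ZetaScrewThm17.hasSum_real hRH t).mul_left 4)

end Summit.RiemannHypothesis.RiemannHypothesis.Theorems.ScrewSquaringLaw
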